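import Literature.MathematicalPhysics.QuantumFieldTheory.Balaban1983to89.B6Eq295

/-!
# `Balaban1983to89.B6Eq2130` — T. Bałaban, *Propagators and renormalization transformations for lattice gauge
# theories. II*, Commun. Math. Phys. **96** (1984) 223–250 [Balaban1984PropagatorsII], Sect. C (2.130)–(2.131) p. 246:
# the printed `H_j = G_jQ_j*(Q_jG_jQ_j*)⁻¹` and `G̃_j = G_j − G_jQ_j*(Q_jG_jQ_j*)⁻¹Q_jG_j` PROVED to be the translation
# operator of (2.112)–(2.113) and a covariance of the constrained Gaussian (2.114)–(2.115)

statement-level skeleton of published theorems with citation tags; proofs where landed; nothing here is a claim about the Yang–Mills mass gap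

PDF held: `paper:balaban1984-cmp96-propagators-rt-ii` (journal page = PDF page + 222); read AS IMAGES on the ×2 renders
`run/shared/lean/pub/pub-balaban/b2b-balaban-ref1/pages/1984-cmp96-propagators-rt-II/…-p021, -p024-x2.png` (pp. 243, 246)
and, for *"Sect. E (1.91)–(1.103)"* of [4] = [Balaban1984PropagatorsI], `…/1984-cmp95-propagators-rt-I/…-p013, -p014, -p017,
-p018-x2.png` (pp. 29–30, 33–34), by this seat (2026-08-21).

CITATION HEADER (lean-in-tree rule).  WHAT IS REPRODUCED: the CONTENT of lit-balaban SKELETON rows **B6.Eq2.130** and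
**B6.Eq2.131** (typed until now as the bare definitions `…B6SectA.hOp` (pattern `GQ*E`) and `…B6SectA.tildeOp`
(`S − SQ*EQS`)): that these printed operators ARE the `H_j` and `G̃_j` of (2.112)–(2.119), i.e. that they DISCHARGE the
hypotheses `hcrit` / `hsol` under which `…B6Eq295.eq2113_2114`, `eq2115`, `eq2116` and `…B6GaussianIdentity2119.eq2119`
were proved; part 1/2 of PHASE-2 seat p22 (gen 2) on row **B6.Eq2.129** (part 2/2 = `…B6Repr2129`, which imports this
file); owner r03, referee ref-4.  Abstract carriers and conventions of `…B6Eq295` §4 (real inner-product spaces, adjoints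
as hypotheses, δ-function integrals over a parameter space with a left-invariant measure, no integrability hypotheses);
nothing of any existing module is restated or modified — `…B6SectA.hOp`/`tildeOp`/`comp_tildeOp_eq_zero`/
`critical221_unique` and `…B6Eq295.eq2115`/`eq2116` are consumed by name.

PRINT (p. 246 [PDF 24], verbatim, after (2.129)).  *"We have to investigate yet the operators G̃_j, H_j, and H′_j. Doing
similar calculations as in Sect. E. (1.91)–(1.103), in fact much simpler, we get the formula H_j = G_jQ_j*(Q_jG_jQ_j*)⁻¹.
(2.130) Thus this operator coincides with the operator introduced in Sect. D. For G̃_j we get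
G̃_j = G_j − G_jQ_j*(Q_jG_jQ_j*)⁻¹Q_jG_j. (2.131)"*  Context (p. 243): `H_j` is the translation `A → A + H_jB` of the
fibre integral `∫dAδ(Q_jA − B)exp[−½⟨A,(Δ−∂P_j∂*)A⟩ + ⟨A, J − …⟩]` of (2.112) (*"The operator H_j may be different from the
operator defined in Sect. D of [4], because there is the exponential gauge fixing term instead of the δ-function, but we
will prove later that they are equal"*), which *"gives the factor (2.113) and separates the integral over A (2.114). Let
us denote a covariance of this Gaussian integral by G̃_j"*.  [4] (1.69)–(1.71) p. 29–30: `Δ_a = Δ − ∂P∂* + aQ*Q`,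
`Δ_a⁻¹ = G_k, or simply G`; (1.91)–(1.92) p. 33: *"h(A, ω, λ) = ½⟨A, Δ_aA⟩ + ⟨ω, QA−B⟩ + ⟨λ, R∂*A⟩, … δh/δA = Δ_aA + Q*ω
+ ∂λ = 0, δh/δω = QA − B = 0, δh/δλ = R∂*A = 0"*; (1.103) p. 34: *"H_kB = GQ*(QGQ*)⁻¹B"*.

WHAT IS TYPED / PROVED (no deferred proofs; every hypothesis displayed).  Data: `M` (= Δ − ∂P_j∂*), `Q_j` with adjoint
`Q_j*` (`hQ`), `a`, `G_j` a right inverse of `M + Q_j*aQ_j` (= Δ_a with blocks of order j — READING: print does not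
display `G_j` in this paper; *"as in Sect. E (1.91)–(1.103)"* and *"the operator introduced in Sect. D"* fix it as [4]
(1.71); `a` is a number in print, an operator on the `Q_j`-fields here), `E` a right inverse of `Q_jG_jQ_j*`.
* (2.130), *"in fact much simpler"* = the Lagrange system (1.92) WITHOUT the multiplier `λ` (no `R∂*A = 0` constraint
  under the exponential gauge fixing): `Q_hOp` (`Q_jH_j = I`), `M_hOp` (Euler–Lagrange equation `MH_jB = Q_j*ω`),
  **`hOp_crit`** (`MH_jB ⊥ {Q_jA = 0}` = the hypothesis `hcrit`, DISCHARGED), `hOp_minimises` / `hOp_unique` (H_jB is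
  the / the only critical configuration of `½⟨A,MA⟩` on `{Q_jA = B}`), `minimisers_coincide` (*"coincides with the
  operator introduced in Sect. D"*: the δ-gauge critical configuration of `…B6SectA.critical221_unique` is the same).
* (2.131): **`Q_tildeOp`** (range in `{Q_jA = 0}`), **`tildeOp_sol`** (inverts `M` there = the hypothesis `hsol`, DISCHARGED).
* `eq2116_printed`, `eq2115_printed`: (2.116) and (2.115) with THE printed operators (for (2.115) what remains of `G̃_j`
  is its expression `G̃_j = ι∘T` in the chosen coordinates `ι` of `{Q_jA = 0}`).
Unit `lit-balaban-p22` (PHASE-2 proof seat, gen 2), HOME `run/shared/lean/pub/lit-balaban/`, 2026-08-21.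
-/

noncomputable section

open MeasureTheory
open scoped InnerProductSpace

namespace Literature.MathematicalPhysics.QuantumFieldTheory.Balaban1983to89.B6Eq2130

/-! ## (2.130)–(2.131): the printed `H_j = G_jQ_j*(Q_jG_jQ_j*)⁻¹`, `G̃_j = G_j − G_jQ_j*(Q_jG_jQ_j*)⁻¹Q_jG_j` -/

section PrintedOperators

variable {A : Type*} [NormedAddCommGroup A] [InnerProductSpace ℝ A]
variable {W : Type*} [NormedAddCommGroup W] [InnerProductSpace ℝ W]

/-- `G_j = Δ_a⁻¹` with `Δ_a = (Δ − ∂P_j∂*) + Q_j*aQ_j` ([4] (1.69)–(1.71), *"blocks uniformly of order j"*): for `G` a right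
inverse of `M + Q*aQ`, `M(Gx) = x − Q*aQGx`. [cite: Balaban1984PropagatorsII, (2.130) p.246] -/
theorem apply_G_eq (M G : A →ₗ[ℝ] A) (Q : A →ₗ[ℝ] W) (Qs : W →ₗ[ℝ] A) (a : W →ₗ[ℝ] W)
    (hG : (M + Qs ∘ₗ a ∘ₗ Q) ∘ₗ G = LinearMap.id) (x : A) :
    M (G x) = x - Qs (a (Q (G x))) := by
  have h := LinearMap.congr_fun hG x
  simp only [LinearMap.coe_comp, Function.comp_apply, LinearMap.add_apply, LinearMap.id_coe, id_eq] at h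
  exact eq_sub_of_add_eq h

/-- **(2.130): `Q_jH_j = I`** for `H_j = G_jQ_j*(Q_jG_jQ_j*)⁻¹` (`…B6SectA.hOp G Q_j* E`, `E` a right inverse of
`Q_jG_jQ_j*`) — [4] (1.92)₂ *"δh/δω = QA − B = 0"*; used again at (2.145)–(2.146) p. 248 (*"Q_jH_j = I"*).
[cite: Balaban1984PropagatorsII, (2.130) p.246] -/
theorem Q_hOp (G : A →ₗ[ℝ] A) (Q : A →ₗ[ℝ] W) (Qs : W →ₗ[ℝ] A) (E : W →ₗ[ℝ] W)
    (hE : (Q ∘ₗ G ∘ₗ Qs) ∘ₗ E = LinearMap.id) (b : W) :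
    Q (B6SectA.hOp G Qs E b) = b := by
  simpa [B6SectA.hOp] using LinearMap.congr_fun hE b

/-- **The Euler–Lagrange equation behind (2.130)** ([4] (1.92)₁ without the `∂λ` multiplier — *"in fact much simpler"*:
there is no `R∂*A = 0` constraint under the exponential gauge fixing): `(Δ − ∂P_j∂*)H_jB = Q_j*ω` with
`ω = (Q_jG_jQ_j*)⁻¹B − aB`. [cite: Balaban1984PropagatorsII, (2.130) p.246] -/
theorem M_hOp (M G : A →ₗ[ℝ] A) (Q : A →ₗ[ℝ] W) (Qs : W →ₗ[ℝ] A) (a E : W →ₗ[ℝ] W)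
    (hG : (M + Qs ∘ₗ a ∘ₗ Q) ∘ₗ G = LinearMap.id) (hE : (Q ∘ₗ G ∘ₗ Qs) ∘ₗ E = LinearMap.id) (b : W) :
    M (B6SectA.hOp G Qs E b) = Qs (E b - a b) := by
  have h1 : B6SectA.hOp G Qs E b = G (Qs (E b)) := by simp [B6SectA.hOp]
  have h2 : Q (G (Qs (E b))) = b := by simpa using LinearMap.congr_fun hE b
  rw [h1, apply_G_eq M G Q Qs a hG, h2, map_sub]

/-- **(2.130) gives the translation operator of (2.112)–(2.113):** `(Δ − ∂P_j∂*)H_jB ⊥ {Q_jA = 0}` — the hypothesis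
`hcrit` of `…B6Eq295.eq2113_2114` / `eq2116` and of `…B6GaussianIdentity2119.eq2119`, DISCHARGED for the printed
`H_j = G_jQ_j*(Q_jG_jQ_j*)⁻¹` (`Q_j*` the adjoint of `Q_j`). [cite: Balaban1984PropagatorsII, (2.130) p.246] -/
theorem hOp_crit (M G : A →ₗ[ℝ] A) (Q : A →ₗ[ℝ] W) (Qs : W →ₗ[ℝ] A) (a E : W →ₗ[ℝ] W)
    (hQ : ∀ (w : W) (v : A), ⟪Qs w, v⟫_ℝ = ⟪w, Q v⟫_ℝ)
    (hG : (M + Qs ∘ₗ a ∘ₗ Q) ∘ₗ G = LinearMap.id) (hE : (Q ∘ₗ G ∘ₗ Qs) ∘ₗ E = LinearMap.id)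
    (b : W) (v : A) (hv : Q v = 0) :
    ⟪v, M (B6SectA.hOp G Qs E b)⟫_ℝ = 0 := by
  rw [M_hOp M G Q Qs a E hG hE, real_inner_comm, hQ, hv, inner_zero_right]

/-- **`H_jB` minimises `½⟨A,(Δ − ∂P_j∂*)A⟩` on `{Q_jA = B}`** ([4] p. 33: *"It is defined as a minimum of the form …
under the conditions QA = B"*, here without `R∂*A = 0`), whenever the form is non-negative on `{Q_jA = 0}`.
[cite: Balaban1984PropagatorsII, (2.130) p.246] -/
theorem hOp_minimises (M G : A →ₗ[ℝ] A) (Q : A →ₗ[ℝ] W) (Qs : W →ₗ[ℝ] A) (a E : W →ₗ[ℝ] W)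
    (hM : ∀ x y : A, ⟪M x, y⟫_ℝ = ⟪x, M y⟫_ℝ) (hQ : ∀ (w : W) (v : A), ⟪Qs w, v⟫_ℝ = ⟪w, Q v⟫_ℝ)
    (hG : (M + Qs ∘ₗ a ∘ₗ Q) ∘ₗ G = LinearMap.id) (hE : (Q ∘ₗ G ∘ₗ Qs) ∘ₗ E = LinearMap.id)
    (hpos : ∀ v : A, Q v = 0 → 0 ≤ ⟪v, M v⟫_ℝ) (b : W) (A' : A) (hA' : Q A' = b) :
    ⟪B6SectA.hOp G Qs E b, M (B6SectA.hOp G Qs E b)⟫_ℝ ≤ ⟪A', M A'⟫_ℝ := by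
  set h := B6SectA.hOp G Qs E b with hh
  have hQh : Q h = b := Q_hOp G Q Qs E hE b
  have hv : Q (A' - h) = 0 := by rw [map_sub, hA', hQh, sub_self]
  have h1 : ⟪A' - h, M h⟫_ℝ = 0 := hOp_crit M G Q Qs a E hQ hG hE b (A' - h) hv
  have h2 : ⟪h, M (A' - h)⟫_ℝ = 0 := by rw [← hM, real_inner_comm, h1]
  have key : ⟪h + (A' - h), M (h + (A' - h))⟫_ℝ = ⟪h, M h⟫_ℝ + ⟪A' - h, M (A' - h)⟫_ℝ := by
    rw [map_add, inner_add_left, inner_add_right, inner_add_right, h1, h2]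
    ring
  have hx : h + (A' - h) = A' := by abel
  rw [hx] at key
  rw [key]
  exact le_add_of_nonneg_right (hpos _ hv)

/-- **Uniqueness of the critical configuration** (the "exactly one solution" half of the computation (1.91)–(1.103)
of [4], here for the exponential gauge fixing): if the form is positive definite on `{Q_jA = 0}`, any `A′` with
`Q_jA′ = B` and `(Δ − ∂P_j∂*)A′ ⊥ {Q_jA = 0}` IS `H_jB`. [cite: Balaban1984PropagatorsII, (2.130) p.246] -/
theorem hOp_unique (M G : A →ₗ[ℝ] A) (Q : A →ₗ[ℝ] W) (Qs : W →ₗ[ℝ] A) (a E : W →ₗ[ℝ] W)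
    (hQ : ∀ (w : W) (v : A), ⟪Qs w, v⟫_ℝ = ⟪w, Q v⟫_ℝ)
    (hG : (M + Qs ∘ₗ a ∘ₗ Q) ∘ₗ G = LinearMap.id) (hE : (Q ∘ₗ G ∘ₗ Qs) ∘ₗ E = LinearMap.id)
    (hdef : ∀ v : A, Q v = 0 → ⟪v, M v⟫_ℝ = 0 → v = 0) (b : W) (A' : A) (hA' : Q A' = b)
    (hcritA : ∀ v : A, Q v = 0 → ⟪v, M A'⟫_ℝ = 0) :
    A' = B6SectA.hOp G Qs E b := by
  set h := B6SectA.hOp G Qs E b with hh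
  have hQh : Q h = b := Q_hOp G Q Qs E hE b
  have hv : Q (A' - h) = 0 := by rw [map_sub, hA', hQh, sub_self]
  have hc : ⟪A' - h, M h⟫_ℝ = 0 := hOp_crit M G Q Qs a E hQ hG hE b (A' - h) hv
  have h1 : ⟪A' - h, M (A' - h)⟫_ℝ = 0 := by
    rw [map_sub, inner_sub_right, hcritA _ hv, hc, sub_zero]
  exact sub_eq_zero.mp (hdef _ hv h1)

/-- **"Thus this operator coincides with the operator introduced in Sect. D"** (p. 246, after (2.130)).  The operator of
Sect. D of [4] is the critical configuration of the δ-function gauge fixing — the Lagrange system [4] (1.92) with the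
extra multiplier `λ`, `Rλ = λ`, typed in the tree as the hypotheses of `…B6SectA.critical221_unique` ((2.21) of this
paper, same algebra) — and that theorem shows it equals `hOp G Q* E`; by `hOp_unique` so does the critical configuration
of the exponential gauge fixing.  Hence the two configurations are EQUAL (for the same `G = Δ_a⁻¹`, (2.31)/(2.34)-type
identities `h231`, `h234`, and `E` a two-sided inverse of `QGQ*`). [cite: Balaban1984PropagatorsII, (2.130) p.246] -/
theorem minimisers_coincide {V : Type*} [AddCommGroup V] [Module ℝ V]
    (M G : A →ₗ[ℝ] A) (Q : A →ₗ[ℝ] W) (Qs : W →ₗ[ℝ] A) (a E : W →ₗ[ℝ] W)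
    (d : V →ₗ[ℝ] A) (dstar : A →ₗ[ℝ] V) (Rp : V →ₗ[ℝ] V)
    (hQ : ∀ (w : W) (v : A), ⟪Qs w, v⟫_ℝ = ⟪w, Q v⟫_ℝ)
    (hG : (M + Qs ∘ₗ a ∘ₗ Q) ∘ₗ G = LinearMap.id) (hG' : G ∘ₗ (M + Qs ∘ₗ a ∘ₗ Q) = LinearMap.id)
    (hE : (Q ∘ₗ G ∘ₗ Qs) ∘ₗ E = LinearMap.id) (hE' : E ∘ₗ (Q ∘ₗ G ∘ₗ Qs) = LinearMap.id)
    (h231 : Rp ∘ₗ dstar ∘ₗ G ∘ₗ d ∘ₗ Rp = Rp) (h234 : Rp ∘ₗ dstar ∘ₗ G ∘ₗ Qs = 0)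
    (hdef : ∀ v : A, Q v = 0 → ⟪v, M v⟫_ℝ = 0 → v = 0) (b : W)
    {A₁ : A} (hA₁ : Q A₁ = b) (hcrit₁ : ∀ v : A, Q v = 0 → ⟪v, M A₁⟫_ℝ = 0)
    {A₂ : A} {lam : V} {ω : W} (hR : Rp lam = lam)
    (h1 : (M + Qs ∘ₗ a ∘ₗ Q) A₂ - d (Rp lam) - Qs ω = 0) (h2 : Rp (dstar A₂) = 0) (h3 : Q A₂ = b) :
    A₁ = A₂ := by
  rw [hOp_unique M G Q Qs a E hQ hG hE hdef b A₁ hA₁ hcrit₁,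
    (B6SectA.critical221_unique (M + Qs ∘ₗ a ∘ₗ Q) G d dstar Rp Q Qs E hG' h231 h234 hE' hR h1 h2 h3).2.2]

/-- **(2.131) ranges in the constraint subspace:** `Q_jG̃_j = 0` for the printed `G̃_j = G_j − G_jQ_j*(Q_jG_jQ_j*)⁻¹Q_jG_j`
(= `…B6SectA.tildeOp G_j Q_j Q_j* E`; this is `…B6SectA.comp_tildeOp_eq_zero`, pointwise).
[cite: Balaban1984PropagatorsII, (2.131) p.246] -/
theorem Q_tildeOp (G : A →ₗ[ℝ] A) (Q : A →ₗ[ℝ] W) (Qs : W →ₗ[ℝ] A) (E : W →ₗ[ℝ] W)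
    (hE : (Q ∘ₗ G ∘ₗ Qs) ∘ₗ E = LinearMap.id) (J : A) :
    Q (B6SectA.tildeOp G Q Qs E J) = 0 := by
  simpa using LinearMap.congr_fun (B6SectA.comp_tildeOp_eq_zero G Q Qs E hE) J

/-- **(2.131) is a covariance of the constrained Gaussian (2.114):** for every `v` with `Q_jv = 0`,
`⟨v, (Δ − ∂P_j∂*)G̃_jJ⟩ = ⟨v, J⟩` — the hypothesis `hsol` of `…B6Eq295.eq2115` DISCHARGED for the printed `G̃_j`
(`G_j` a right inverse of `(Δ − ∂P_j∂*) + Q_j*aQ_j`, `Q_j*` the adjoint of `Q_j`; no hypothesis on `E` is needed here).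
[cite: Balaban1984PropagatorsII, (2.131) p.246] -/
theorem tildeOp_sol (M G : A →ₗ[ℝ] A) (Q : A →ₗ[ℝ] W) (Qs : W →ₗ[ℝ] A) (a E : W →ₗ[ℝ] W)
    (hQ : ∀ (w : W) (v : A), ⟪Qs w, v⟫_ℝ = ⟪w, Q v⟫_ℝ)
    (hG : (M + Qs ∘ₗ a ∘ₗ Q) ∘ₗ G = LinearMap.id) (v J : A) (hv : Q v = 0) :
    ⟪v, M (B6SectA.tildeOp G Q Qs E J)⟫_ℝ = ⟪v, J⟫_ℝ := by
  have hQs : ∀ w : W, ⟪v, Qs w⟫_ℝ = 0 := fun w => by rw [real_inner_comm, hQ, hv, inner_zero_right]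
  have hx : B6SectA.tildeOp G Q Qs E J = G J - G (Qs (E (Q (G J)))) := by simp [B6SectA.tildeOp]
  rw [hx, map_sub, apply_G_eq M G Q Qs a hG, apply_G_eq M G Q Qs a hG, inner_sub_right, inner_sub_right,
    inner_sub_right, hQs, hQs, hQs]
  ring

variable {N : Type*} [AddCommGroup N] [Module ℝ N] [MeasurableSpace N]

/-- **(2.116) with THE printed `H_j` (2.130):** `∫dAδ(Q_jA − B)e^{−½⟨A,(Δ−∂P_j∂*)A⟩} = e^{−½⟨H_jB,(Δ−∂P_j∂*)H_jB⟩}·Z̃_j`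
(`…B6Eq295.eq2116` with its hypothesis `hcrit` supplied by `hOp_crit`; fibre parametrised as `ι n + H_jB`, any measure).
[cite: Balaban1984PropagatorsII, (2.116) p.243 + (2.130) p.246] -/
theorem eq2116_printed (μ : Measure N) (ι : N →ₗ[ℝ] A) (M G : A →ₗ[ℝ] A) (Q : A →ₗ[ℝ] W) (Qs : W →ₗ[ℝ] A)
    (a E : W →ₗ[ℝ] W) (hM : ∀ x y : A, ⟪M x, y⟫_ℝ = ⟪x, M y⟫_ℝ)
    (hQ : ∀ (w : W) (v : A), ⟪Qs w, v⟫_ℝ = ⟪w, Q v⟫_ℝ)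
    (hG : (M + Qs ∘ₗ a ∘ₗ Q) ∘ₗ G = LinearMap.id) (hE : (Q ∘ₗ G ∘ₗ Qs) ∘ₗ E = LinearMap.id)
    (hι : ∀ n, Q (ι n) = 0) (b : W) :
    ∫ n, Real.exp (-(1 / 2) * ⟪ι n + B6SectA.hOp G Qs E b, M (ι n + B6SectA.hOp G Qs E b)⟫_ℝ) ∂μ =
      Real.exp (-(1 / 2) * ⟪B6SectA.hOp G Qs E b, M (B6SectA.hOp G Qs E b)⟫_ℝ) *
        ∫ n, Real.exp (-(1 / 2) * ⟪ι n, M (ι n)⟫_ℝ) ∂μ :=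
  B6Eq295.eq2116 μ ι M Q hM hι _ (fun v hv => hOp_crit M G Q Qs a E hQ hG hE b v hv)

/-- **(2.115) with THE printed `G̃_j` (2.131):** for a left-invariant `μ` on coordinates `ι` of `{Q_jA = 0}` in which
`G̃_j = ι∘T` (possible since `Q_jG̃_j = 0`, `Q_tildeOp`), `∫dAδ(Q_jA) e^{−½⟨A,(Δ−∂P_j∂*)A⟩+⟨A,J⟩} = e^{½⟨J,G̃_jJ⟩}·Z̃_j`
(`…B6Eq295.eq2115` with its hypothesis `hsol` supplied by `tildeOp_sol`). [cite: Balaban1984PropagatorsII, (2.115) p.243 + (2.131) p.246] -/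
theorem eq2115_printed [MeasurableAdd N] (μ : Measure N) [μ.IsAddLeftInvariant] (ι : N →ₗ[ℝ] A) (T : A →ₗ[ℝ] N)
    (M G : A →ₗ[ℝ] A) (Q : A →ₗ[ℝ] W) (Qs : W →ₗ[ℝ] A) (a E : W →ₗ[ℝ] W)
    (hM : ∀ x y : A, ⟪M x, y⟫_ℝ = ⟪x, M y⟫_ℝ) (hQ : ∀ (w : W) (v : A), ⟪Qs w, v⟫_ℝ = ⟪w, Q v⟫_ℝ)
    (hG : (M + Qs ∘ₗ a ∘ₗ Q) ∘ₗ G = LinearMap.id) (hι : ∀ n, Q (ι n) = 0)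
    (hT : ∀ J, B6SectA.tildeOp G Q Qs E J = ι (T J)) (J : A) :
    ∫ n, Real.exp (-(1 / 2) * ⟪ι n, M (ι n)⟫_ℝ + ⟪ι n, J⟫_ℝ) ∂μ =
      Real.exp ((1 / 2) * ⟪J, B6SectA.tildeOp G Q Qs E J⟫_ℝ) *
        ∫ n, Real.exp (-(1 / 2) * ⟪ι n, M (ι n)⟫_ℝ) ∂μ :=
  B6Eq295.eq2115 μ ι M _ T hM hT (fun n J' => tildeOp_sol M G Q Qs a E hQ hG (ι n) J' (hι n)) J

end PrintedOperators

end Literature.MathematicalPhysics.QuantumFieldTheory.Balaban1983to89.B6Eq2130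

end
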